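import Mathlib
import HarnessLib
import HarnessLib.Audit
import Summits.MatrixMultiplication.Statement
import Summits.MatrixMultiplication.MatrixMultiplication.Theorems.AbelianSTPPCensusTargets
import Summits.MatrixMultiplication.MatrixMultiplication.Theorems.AbelianSTPPSieve
import HarnessLib.Audit.Status.Attr

/-!
Route: AbelianSTPPCensus

CLOSED (proved) 2026-08-26T09:30:57Z by planner-director-frontier-g4-0 — reason: proved:Summit.MatrixMultiplication.MatrixMultiplication.Theorems.noAbelianSTPPHost_250_127 — note: director-frontier g4: PROVED close per 21-frontier 2026-08-26T09:14:15Z (route close --proved live; directors may use it) answering REQUESTS l.678 (mm-stpp-plan g6 01:06:24Z ruling ask): 6/6 items closed proved; capstone noAbelianSTPPHost_250_127 (p416213, AbelianSTPPCensusLeafTE127Closed.lean, axio. The file is kept as the record of this route; refuted decls are indexed as negative knowledge (`ledger negatives`).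

# Route AbelianSTPPCensus — No abelian STPP host of order at most 127 beats exponent 5/2

Rung F-M1 of the MatrixMultiplication ladder (cell mm-stpp, D-0046/D-0059/D-0061): it suffices to
show X = «for every finite
abelian group H with |H| ≤ 127 and every STPP family (A_i,B_i,C_i) in H (CKSU 2005 Def 5.1, tree
predicate `IsSTPP`),
Σ_i (|A_i||B_i||C_i|)^{5/6} ≤ |H|» — no abelian host of order ≤ 127 certifies ω < 5/2 by the
group-theoretic packing
bound. X is the rung leaf `NoAbelianSTPPHost_250_127` (ALT-CLOSER, class rung leaf; never summit
credit). X = X_arith ∧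
X_struct: an arithmetic exclusion of all shape multisets by packing inequalities that are theorems
for STPP families
(X_arith, decidable), and the non-existence of the finitely many residual four-member configurations
at orders
111, 120, 121, 124, 125, 126, 127 (X_struct). As of 2026-08-25T20Z every one of these residual
instances is settled NO at
hand + referee level — 125: eng-1's kernel THEOREM B (p403556, main file p403830 pending) and the
refereed slack-run proof Q3.8;
111/120: the lit seat's Kneser-type kills (KNESER-KILLS.md §3, REF PASS); 121/124/126/127: eng-2's
near-period / additive-energy
method (TE-RESIDUALS.md §§1–5, REF PASS) — so the least abelian order not excluded for T_E stands at
≥ 128 (hand+REF class);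
UPDATE 21:40Z: every residual INSTANCE (111 · 120 ×3 · 121 ×3 · 124 ×4 · 125 ×2 · 126 · 127,
exact-family form) is now a KERNEL
theorem (eng-2, ns `…Theorems.STPPEnergy`: p406327/p407036/p408339/p408435/p408603 ACCEPTED) and the
residual LIST is two-lineage
(REF [46]: an independent DFS reproduces it multiset-for-multiset); what the route's items still ask
for in kernel form is the
replayable certificate for X_arith (`ShapeExclusionTE`) plus the contains-form wrappers / sieve
soundness / glue (theory, pending).
Lean: `Summit.MatrixMultiplication.MatrixMultiplication.Theorems.NoAbelianSTPPHost_250_127`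

## Assembly
Pure logic after the glue: given H with |H| ≤ 127 and an STPP family, drop the members with an empty
set (their volume term is 0 and
`IsSTPP` restricts to sub-families); with ≤ 1 member U1 gives the bound; with ≥ 2 members SieveSound
puts the shape list in the sieve
system, ShapeExclusionTE either bounds the sum or exhibits a residual order and sub-multiset, which
TEOrder125 / TEResidualSmall /
TEResidualLarge exclude. This implication (the former glue item) IS the `Assembly` item below — a
statement item provers close like any other (theory's `noAbelianSTPPHost_250_127_of_cruxes`,
p406973, has exactly this body); the deciding theorem `closes` takes the four cruxes, `SieveSound`
and `Assembly` (six binders, all load-bearing; nothing declared outside the cone).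

CLOSES_TARGET: closes rung F-M1.T_E/127 of MatrixMultiplication: Summit.MatrixMultiplication.MatrixMultiplication.Theorems.NoAbelianSTPPHost_250_127 (D-0061; not the summit Statement) — the deciding theorem of this route concludes that registered leaf instead of the Statement decl `MatrixMultiplication` (class rung: servable and labelled, never counted as concluding the summit Statement).

Rationale: WHY THIS LINE. The group-theoretic approach needs STPP families with Σ V_i^{ω/3} close to |H|
(CohnKleinbergSzegedyUmans2005 Thm 5.5,
BlasiakChurchCohnGrochowNaslundSawinUmans2017 (1.1)); slice rank kills bounded exponent
asymptotically (BCCGNSU Thm B, in tree)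
but says nothing about which small abelian groups host good families. The cell's census replaces
asymptotics by a complete
finite instrument: every packing consequence of `IsSTPP` that is a theorem (BCCGNSU §2 packing, a
Neumann-type bound
`stpp_neumann_packing` and its sharp form `isSTPP_neumann_packing_sharp` (eng-1, p402899/p403985) in
their PER-MEMBER form «Σ_t c_t(a_t+b_t) ≤
|H| + c_i for every member i» (Theorem A per block = Kemperman–Scherk–Wehn composed with the STPP
bookkeeping, now `Literature.Combinatorics.Additive.KempermanScherk` p405082; lit seat
KNESER-KILLS.md §1, an exact disjointness count), the one-volume bound U14 with
its tightness/divisibility clauses from set-periodicity (planner kernel sketch, 46 theorems), pair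
isolation U9′/U13) is fed
to an exhaustive shape-level search, and what survives is a short explicit list of four-member
instances decided by structure
(coset forcing, the slack-run lemma, eng-2's near-period lemma |E∩(E+(x−x′))| ≥ h(x)+h(x′)−|F| with
the additive-energy test,
the lit seat's second-moment slack rule U11-Δ) or by SAT. Imported: additive combinatorics
(stabilisers/periodicity à la Kneser, factor-
isation language of Hajós–Rédei–Sands for the tight cases), certified enumeration. Prior routes
(GroupTheoreticSTPP and its
offspring) attack the asymptotic statement; the negatives index has no finite-order census
statement.

RANKED CRUXES. #2 ShapeExclusionTE (crux) — every shape list with ≥ 2 members that satisfies the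
sieve system `SieveAdmissible M` (U1, Neumann, U2, U11 per member, U13, U9′, U14, U14-T, U14-T″) and
beats 5/2 at an order M ≤ 127 has M ∈ {111,120,121,124,125,126,127} and contains one of the listed
residual sub-multisets (the census's exhaustive DFS verdicts under rule set vM, lineage A′: planner
local run 2026-08-25T19:1xZ, kit certificate job j244071; to be replayed from a certificate).
[difficulty: L] (why it might fail: the DFS tests Σ V^{5/6} > M in floating point with float pruning
bounds — an exact replay could expose a boundary multiset (4·64^{5/6} = 128 exactly sits one order
above the range); lineage-B's full re-run (j244341) is pending; a 10⁶-node search needs a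
Lean-checkable certificate.) [arXiv:1605.06702, arXiv:math/0511460, HedtkeMurthy2012]
#3 TEResidualSmall (crux) — no STPP family in an abelian group of order 111 contains three (4,4,4)
members and a (3,3,3) member, and none of order 120 or 121 contains three (4,4,4) members and a
member of shape (4,4,3), (4,3,4) or (3,4,4) (questions Q3.9/Q3.10 of the census; settled NO by
refereed hand proofs, kernel form wanted). [difficulty: M] (why it might fail: the refereed hand
kills (lit KNESER-KILLS §3.1–3.2: 111/120; eng-2 TE-RESIDUALS §3: 121, chain 31 ⇒ 55 ⇒ 99) use
Kneser at composite orders (Literature p406580, pending); a missed stabiliser case or an uncovered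
rotation instance at 120/121 would hide a family (U14 slack 9–13, nothing tight).)
[arXiv:math/0511460, arXiv:1605.06702, HedtkeMurthy2012]
#4 TEResidualLarge (crux) — no STPP family in an abelian group of order 124 contains one of the four
residual four-member sub-multisets ((5,4,3)+(3,4,5)+(4,4,4)×2 and its two rotations, (4,4,4)×4), and
none of order 126 or 127 contains four (4,4,4) members (Q3.11/Q3.12; settled NO by eng-2's refereed
hand proofs, kernel form wanted — 127 via Cauchy–Davenport only). [difficulty: M] (why it might
fail: 127 needs only Cauchy–Davenport, but the refereed 126 kill (TE-RESIDUALS §4) is an exhaustive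
Kneser case split over the subgroup lattice plus an index-2 endgame where the Freiman-3/2 shortcut
fails (divisor 63 in range); a missed case would hide a family with U14 slack 14–15.)
[arXiv:math/0511460, arXiv:1605.06702]
#5 TEOrder125 (crux) — no STPP family in an abelian group of order 125 contains four (4,4,4) members
(eng-1 THEOREM B, kernel p403556/p403830) or members of shapes (5,5,3),(5,3,5),(3,5,5),(3,3,3)
(planner hand proof Q38-SLACK-PROOF: slack-1 rotations force an order-25 stabiliser K, K₁ = K₂ = K₃,
then |A₂−B₂+C₂| ≤ 25 < 75). [difficulty: M] (why it might fail: conjunct 1's main file p403830 is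
still PENDING (lemmas p403556 accepted); conjunct 2 rests on the slack-run Lemma S and a ℤ₁₂₅
run-escape argument (REF PASS, flags N1/N2: the {x₀,±δ}-pin clause needs ⟨δ⟩ = H) — a gap in Lemma S
or a dropped side condition reopens Q3.8.) [arXiv:math/0511460, Redei1965, arXiv:1605.06702]
#9 SieveSound (support) — every STPP family with nonempty sets in a finite abelian group satisfies
the sieve system at its shape list (U1, Neumann, U2 = BCCGNSU §2, U11 per member = the fixed-x₀ form
of `stpp_neumann_packing` / `isSTPP_neumann_packing_sharp`, U14 = tree
`sum_card_mul_add_card_sumset_le` (p404150), U13/U9′/U14-T/U14-T″ =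
HOME/mm-stpp-plan/PackingSketch.lean, kernel-checked, to be ported over the tree predicate).
[difficulty: provable-now] [arXiv:1605.06702, arXiv:math/0511460]

TWO-LAYER PLAN. ShapeExclusionTE ⇐ (orders ≤ 110) → (residual structure at 111–127) →
ShapeExclusionTE once a certificate format exists; TEResidualLarge
⇐ (order 124) → (orders 126/127) if the engines close 124 first; a sibling leaf
`NoAbelianSTPPHost_2371_300` (T_A at every abelian
order ≤ 300, sieve v3 already EXCLUDED 2–300) is the natural second route/leaf once this one is
open.

KILL CRITERIA. A single STPP family realising any residual instance (a YES to Q3.9–Q3.12) refutes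
TEResidualSmall or TEResidualLarge and with it the
leaf _250_127 as typed: the route then re-targets the largest certified leaf
(`NoAbelianSTPPHost_250_110`, or _250_M for the least
failing M minus one) by a dated CENSUS-PLAN line — the census reading «T_E row at that order» is
pre-registered. An exact-arithmetic
counterexample to ShapeExclusionTE (a boundary multiset the float DFS missed) forces a re-run, not a
pivot.

NOT DECOMPOSED YET. The certificate format for ShapeExclusionTE (per-order DFS trace vs.
interval-arithmetic pruning bounds), the port of the kernel sketch
to the tree predicate (SieveSound's ten conjuncts are separate lemmas), and the per-group split of
the residual instances (3 abelian
groups of order 120, 2 of 121/124/126) are layer-2 work.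

CHEAPEST FALSIFIER. eng-2's SAT probe of the residual instances 111…127 (te_sat.py, kit j244428,
running): ONE model contradicts a refereed hand proof and
kills TEResidualSmall/TEResidualLarge within the hour (UNKNOWN is the expected outcome; UNSAT+DRAT
is the kernel path). Second: re-run the T_E exhaustive sieve 2–127 in exact rational
arithmetic for the value test (kit j244071, rule set vM, is the float run of record).

NUMBERS. τ-tiers of the census: T_A 2.371 (record exponent, arXiv:2307.07970 /
Alman–Duan–Vassilevska Williams–Xu–Xu–Zhou 2.371552), T_E 5/2,
T_F 2.8 (Strassen 2.807). Least abelian order not excluded for T_E: 111 → 121 (REF PASS of the lit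
kills, 19:35Z) → ≥ 128 (REF PASS of eng-2's
TE-RESIDUALS, 19:55Z; hand+REF class, kernel pending) — above 127 the multiset {(4,4,4)×4} stops
beating (4·64^{5/6} = 128) and the vM sieve leaves
(128: 12, 129: 21, 130: 25, …) are the frontier; the lit seat's U11-Δ/U11-Δ⁺ leaf rules claim every
order ≤ 149 (REF pending, kit j244426 to 260). Order 101 and the (5,5,3)+(3,3,5)+(4,4,4)×2 family at
124 are excluded arithmetically by U11 per member (104 > 101+2;
128 > 124+3). Under vM (kit j244071/j244179/j244363 + v9 cross-checks, lineage A′; REF spot rows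
two-lineage): T_A (2.371) excluded at every abelian
order 2–450; T_B (2.375) 2–449 and 450 killed by hand (planner Q313-140-KILL §5 + lit U11-Δ second
proof); T_C (2.4) 2–300; T_D (2.47) ≤ 139 and
142–160, 140 killed by hand (REF PASS), 141 = Q3.13 (lit hand NO, REF pending), silent from 161
(rule-set ceiling M*(T_D) = 161, M*(T_E) = 128).

DEFINITION REQUESTS. Two definition files written and farm-checked by the planner, to be landed
verbatim by a prover seat (W13):
`Summits/MatrixMultiplication/MatrixMultiplication/Theorems/AbelianSTPPCensusTargets.lean`
(`NoAbelianSTPPHostUpTo`, the closed leaves) and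
`Summits/MatrixMultiplication/MatrixMultiplication/Theorems/AbelianSTPPSieve.lean`
(`SieveAdmissible`, `Beats`, `HasSubShapes`, `NoSTPPSubfamily`).

Novelty: Searches (2026-08-25): lit seat LIT-INDEX v1.6.3 for the cell (BCCGNSU §2 packing quoted verbatim;
Neumann Obs 3.1; HedtkeMurthy2012 §4 and HHMM15 single-TPP searches; Alon–Shpilka–Umans 2013 Thm
3.9/3.10); `lean search IsSTPP` (tree: GroupTheoreticMatMul, OmegaCensus STPPDisjointPacking N5,
STPP222Cube* census of (2,2,2)^k); in-house OmegaCensus N1–N5 filters.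
Nearest prior art found: Kemperman–Scherk (Kemperman 1956 / Scherk 1955; Wehn) = the print content
of the per-member packing Theorem A (lit N1-REV; now Literature p405082); HedtkeMurthy2012
(exhaustive TPP search in groups of order ≤ 23, single triples); tree
`Summit.MatrixMultiplication.OmegaCensus.stpp_disjointness_packing` (N5) and the STPP222Cube order
census (fixed shape (2,2,2)); arXiv:1605.06702 Thm B (asymptotic, bounded exponent).
Delta: all shapes and all family sizes at once, at every abelian order up to 127, via new STPP
packing theorems (per-member Neumann packing, U14 with tightness/periodicity clauses, U14-T″ by the
reversal symmetry, the slack-run lemma) — a finite certified census where print has only fixed-shape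
searches or asymptotic barriers.
Claimed grade: new-combination  [refs: 1605.06702, HedtkeMurthy2012]

Barriers (technique_class: additive-combinatorics, packing, finite-census): - technique_class: additive-combinatorics, packing, finite-census
- Literature.Barriers.MatrixMultiplication.TricoloredSumFreeBarrier: does not quantify over this
route — the cruxes are NEGATIVE finite statements about hosts, not an upper-bound method for ω; the
barrier (slice rank ⇒ no ω = 2 from bounded exponent) is consistent with and sharper-in-the-limit
than the census, which in turn is sharper at finite orders.
- Literature.Barriers.MatrixMultiplication.NilpotentGroupBarrier: same placement — abelian ⊂
nilpotent; the barrier limits constructions, the route proves their absence at small orders; no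
evasion needed.
- Literature.Barriers.MatrixMultiplication.QuasirandomBarrier: concerns non-abelian quasirandom
hosts; outside scope (abelian only).
- Literature.Barriers.MatrixMultiplication.GradedPackingBound: outside its technique class — the
barrier caps the VOLUME a (graded / plain-TPP) design can reach (Neumann packing is its J = ℂ^G
case); this route seeks no volume target: it proves NON-existence of STPP families below small
orders and uses Neumann's inequality and its per-member STPP form (U11-min) as INGREDIENTS of the
sieve, so the barrier is an ally, not an obstacle; nothing here claims a design above 0.385·(dim
J)^{3/2}.
- Literature.Barriers.MatrixMultiplication.IrreversibilityBarrier: bounds what tensor-degeneration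
methods can prove about ω; the route makes no claim on ω.
- Literature.Barriers.MatrixMultiplication.BoundedRankFrameBarrier: same SIGN as this route

History (route lifecycle, newest last):
- 2026-08-26T09:30:57Z · CLOSED proved — proved:Summit.MatrixMultiplication.MatrixMultiplication.Theorems.noAbelianSTPPHost_250_127 (planner-director-frontier-g4-0)

sub-problem: MatrixMultiplication · status: closed(proved) · opened planner-mm-stpp-plan-g3-0 2026-08-25T22:13:41Z · rev 0 · ledger route-MatrixMultiplication-AbelianSTPPCensus
GENERATED by the gate from the ledger (D-0016/17). Provers cite these decls: `theorem foo : Summit.MatrixMultiplication.MatrixMultiplication.Theses.AbelianSTPPCensus.<Decl> := …` in Summits/MatrixMultiplication/MatrixMultiplication/Theorems/<Name>.lean.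
-/

namespace Summit.MatrixMultiplication.MatrixMultiplication.Theses.AbelianSTPPCensus

open scoped BigOperators Topology Manifold Classical MeasureTheory ProbabilityTheory Matrix InnerProductSpace ComplexConjugate ContinuousMap
open Filter Set Function TopologicalSpace MeasureTheory

attribute [summit_statement] _root_.MatrixMultiplication
attribute [summit_statement] _root_.Summit.MatrixMultiplication.MatrixMultiplication.Theorems.NoAbelianSTPPHost_250_127

/-- item stmt-MatrixMultiplication-19759 · crux · rank 2 · closed · proved by Summit.MatrixMultiplication.MatrixMultiplication.Theorems.ShapeExclusionTE_proof (prover) · by planner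
why it might fail: the DFS tests Σ V^{5/6} > M in floating point with float pruning bounds — an exact replay could expose a boundary multiset (4·64^{5/6} = 128 exactly sits one order above the range); lineage-B's full re-run (j244341) is pending; a 10⁶-node search needs a Lean-checkable certificate.
sources: arXiv:1605.06702, arXiv:math/0511460, HedtkeMurthy2012
[crux] every shape list with ≥ 2 members that satisfies the sieve system `SieveAdmissible M` (U1,
Neumann, U2, U11 per member, U13, U9′, U14, U14-T, U14-T″) and beats 5/2 at an order M ≤ 127 has M ∈
{111,120,121,124,125,126,127} and contains one of the listed residual sub-multisets (the census's
exhaustive DFS verdicts under rule set vM, lineage A′: planner local run 2026-08-25T19:1xZ, kit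
certificate job j244071; to be replayed from a certificate). [difficulty: L] -/
@[route_item "route-MatrixMultiplication-AbelianSTPPCensus", crux]
def ShapeExclusionTE : Prop :=
  ∀ (N M : ℕ) (a b c : Fin N → ℕ), 2 ≤ N → M ≤ 127 → Summit.MatrixMultiplication.MatrixMultiplication.Theorems.SieveAdmissible M a b c → Summit.MatrixMultiplication.MatrixMultiplication.Theorems.Beats (5 / 2) M a b c → (M = 111 ∧ Summit.MatrixMultiplication.MatrixMultiplication.Theorems.HasSubShapes a b c [(4,4,4),(4,4,4),(4,4,4),(3,3,3)]) ∨ ((M = 120 ∨ M = 121) ∧ (Summit.MatrixMultiplication.MatrixMultiplication.Theorems.HasSubShapes a b c [(4,4,4),(4,4,4),(4,4,4),(4,4,3)] ∨ Summit.MatrixMultiplication.MatrixMultiplication.Theorems.HasSubShapes a b c [(4,4,4),(4,4,4),(4,4,4),(4,3,4)] ∨ Summit.MatrixMultiplication.MatrixMultiplication.Theorems.HasSubShapes a b c [(4,4,4),(4,4,4),(4,4,4),(3,4,4)])) ∨ (M = 124 ∧ (Summit.MatrixMultiplication.MatrixMultiplication.Theorems.HasSubShapes a b c [(5,4,3),(3,4,5),(4,4,4),(4,4,4)]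 ∨ Summit.MatrixMultiplication.MatrixMultiplication.Theorems.HasSubShapes a b c [(5,3,4),(3,5,4),(4,4,4),(4,4,4)] ∨ Summit.MatrixMultiplication.MatrixMultiplication.Theorems.HasSubShapes a b c [(4,5,3),(4,3,5),(4,4,4),(4,4,4)] ∨ Summit.MatrixMultiplication.MatrixMultiplication.Theorems.HasSubShapes a b c [(4,4,4),(4,4,4),(4,4,4),(4,4,4)])) ∨ (M = 125 ∧ (Summit.MatrixMultiplication.MatrixMultiplication.Theorems.HasSubShapes a b c [(4,4,4),(4,4,4),(4,4,4),(4,4,4)] ∨ Summit.MatrixMultiplication.MatrixMultiplication.Theorems.HasSubShapes a b c [(5,5,3),(5,3,5),(3,5,5),(3,3,3)])) ∨ ((M = 126 ∨ M = 127) ∧ Summit.MatrixMultiplication.MatrixMultiplication.Theorems.HasSubShapes a b c [(4,4,4),(4,4,4),(4,4,4),(4,4,4)])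

-- `ShapeExclusionTE` holds: proved by `Summit.MatrixMultiplication.MatrixMultiplication.Theorems.ShapeExclusionTE_proof` (its module imports this route file, so no `_holds` link can be stated here).

/-- item stmt-MatrixMultiplication-19760 · crux · rank 3 · closed · proved by Summit.MatrixMultiplication.MatrixMultiplication.Theorems.TEResidualSmall_proof @ eac0f0ad8e10 (prover) · by planner
why it might fail: the refereed hand kills (lit KNESER-KILLS §3.1–3.2: 111/120; eng-2 TE-RESIDUALS §3: 121, chain 31 ⇒ 55 ⇒ 99) use Kneser at composite orders (Literature p406580, pending); a missed stabiliser case or an uncovered rotation instance at 120/121 would hide a family (U14 slack 9–13, nothing tight).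
sources: arXiv:math/0511460, arXiv:1605.06702, HedtkeMurthy2012
[crux] no STPP family in an abelian group of order 111 contains three (4,4,4) members and a (3,3,3)
member, and none of order 120 or 121 contains three (4,4,4) members and a member of shape (4,4,3),
(4,3,4) or (3,4,4) (questions Q3.9/Q3.10 of the census; settled NO by refereed hand proofs, kernel
form wanted). [difficulty: M] -/
@[route_item "route-MatrixMultiplication-AbelianSTPPCensus", crux]
def TEResidualSmall : Prop :=
  Summit.MatrixMultiplication.MatrixMultiplication.Theorems.NoSTPPSubfamily 111 [(4,4,4),(4,4,4),(4,4,4),(3,3,3)] ∧ (∀ M, M = 120 ∨ M = 121 → Summit.MatrixMultiplication.MatrixMultiplication.Theorems.NoSTPPSubfamily M [(4,4,4),(4,4,4),(4,4,4),(4,4,3)] ∧ Summit.MatrixMultiplication.MatrixMultiplication.Theorems.NoSTPPSubfamily M [(4,4,4),(4,4,4),(4,4,4),(4,3,4)] ∧ Summit.MatrixMultiplication.MatrixMultiplication.Theorems.NoSTPPSubfamily M [(4,4,4),(4,4,4),(4,4,4),(3,4,4)])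

-- `TEResidualSmall` holds: proved by `Summit.MatrixMultiplication.MatrixMultiplication.Theorems.TEResidualSmall_proof` @ eac0f0ad8e10 (its module imports this route file, so no `_holds` link can be stated here).

/-- item stmt-MatrixMultiplication-19761 · crux · rank 4 · closed · proved by Summit.MatrixMultiplication.MatrixMultiplication.Theorems.TEResidualLarge_proof @ eac0f0ad8e10 (prover) · by planner
why it might fail: 127 needs only Cauchy–Davenport, but the refereed 126 kill (TE-RESIDUALS §4) is an exhaustive Kneser case split over the subgroup lattice plus an index-2 endgame where the Freiman-3/2 shortcut fails (divisor 63 in range); a missed case would hide a family with U14 slack 14–15.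
sources: arXiv:math/0511460, arXiv:1605.06702
[crux] no STPP family in an abelian group of order 124 contains one of the four residual four-member
sub-multisets ((5,4,3)+(3,4,5)+(4,4,4)×2 and its two rotations, (4,4,4)×4), and none of order 126 or
127 contains four (4,4,4) members (Q3.11/Q3.12; settled NO by eng-2's refereed hand proofs, kernel
form wanted — 127 via Cauchy–Davenport only). [difficulty: M] -/
@[route_item "route-MatrixMultiplication-AbelianSTPPCensus", crux]
def TEResidualLarge : Prop :=
  (Summit.MatrixMultiplication.MatrixMultiplication.Theorems.NoSTPPSubfamily 124 [(5,4,3),(3,4,5),(4,4,4),(4,4,4)] ∧ Summit.MatrixMultiplication.MatrixMultiplication.Theorems.NoSTPPSubfamily 124 [(5,3,4),(3,5,4),(4,4,4),(4,4,4)] ∧ Summit.MatrixMultiplication.MatrixMultiplication.Theorems.NoSTPPSubfamily 124 [(4,5,3),(4,3,5),(4,4,4),(4,4,4)] ∧ Summit.MatrixMultiplication.MatrixMultiplication.Theorems.NoSTPPSubfamily 124 [(4,4,4),(4,4,4),(4,4,4),(4,4,4)]) ∧ (∀ M, M = 126 ∨ M = 127 → Summit.MatrixMultiplication.MatrixMultiplication.Theorems.NoSTPPSubfamily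 M [(4,4,4),(4,4,4),(4,4,4),(4,4,4)])

-- `TEResidualLarge` holds: proved by `Summit.MatrixMultiplication.MatrixMultiplication.Theorems.TEResidualLarge_proof` @ eac0f0ad8e10 (its module imports this route file, so no `_holds` link can be stated here).

/-- item stmt-MatrixMultiplication-19762 · crux · rank 5 · closed · proved by Summit.MatrixMultiplication.MatrixMultiplication.Theorems.TEOrder125_proof @ eac0f0ad8e10 (prover) · by planner
why it might fail: conjunct 1's main file p403830 is still PENDING (lemmas p403556 accepted); conjunct 2 rests on the slack-run Lemma S and a ℤ₁₂₅ run-escape argument (REF PASS, flags N1/N2: the {x₀,±δ}-pin clause needs ⟨δ⟩ = H) — a gap in Lemma S or a dropped side condition reopens Q3.8.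
sources: arXiv:math/0511460, Redei1965, arXiv:1605.06702
[crux] no STPP family in an abelian group of order 125 contains four (4,4,4) members (eng-1 THEOREM
B, kernel p403556/p403830) or members of shapes (5,5,3),(5,3,5),(3,5,5),(3,3,3) (planner hand proof
Q38-SLACK-PROOF: slack-1 rotations force an order-25 stabiliser K, K₁ = K₂ = K₃, then |A₂−B₂+C₂| ≤
25 < 75). [difficulty: M] -/
@[route_item "route-MatrixMultiplication-AbelianSTPPCensus", crux]
def TEOrder125 : Prop :=
  Summit.MatrixMultiplication.MatrixMultiplication.Theorems.NoSTPPSubfamily 125 [(4,4,4),(4,4,4),(4,4,4),(4,4,4)] ∧ Summit.MatrixMultiplication.MatrixMultiplication.Theorems.NoSTPPSubfamily 125 [(5,5,3),(5,3,5),(3,5,5),(3,3,3)]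

-- `TEOrder125` holds: proved by `Summit.MatrixMultiplication.MatrixMultiplication.Theorems.TEOrder125_proof` @ eac0f0ad8e10 (its module imports this route file, so no `_holds` link can be stated here).

/-- item stmt-MatrixMultiplication-19763 · support · rank 9 · closed · proved by Summit.MatrixMultiplication.MatrixMultiplication.Theorems.SieveSound_proof @ eac0f0ad8e10 (prover) · by planner
sources: arXiv:1605.06702, arXiv:math/0511460
[support] every STPP family with nonempty sets in a finite abelian group satisfies the sieve system
at its shape list (U1, Neumann, U2 = BCCGNSU §2, U11 per member = the fixed-x₀ form of
`stpp_neumann_packing` / `isSTPP_neumann_packing_sharp`, U14 = tree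
`sum_card_mul_add_card_sumset_le` (p404150), U13/U9′/U14-T/U14-T″ =
HOME/mm-stpp-plan/PackingSketch.lean, kernel-checked, to be ported over the tree predicate).
[difficulty: provable-now] -/
@[route_item "route-MatrixMultiplication-AbelianSTPPCensus", crux]
def SieveSound : Prop :=
  ∀ (H : Type) [AddCommGroup H] [Fintype H] (N : ℕ) (A B C : Fin N → Finset H), Literature.Computability.AlgebraicComplexity.IsSTPP A B C → (∀ i, (A i).Nonempty ∧ (B i).Nonempty ∧ (C i).Nonempty) → Summit.MatrixMultiplication.MatrixMultiplication.Theorems.SieveAdmissible (Fintype.card H) (fun i => (A i).card) (fun i => (B i).card) (fun i => (C i).card)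

-- `SieveSound` holds: proved by `Summit.MatrixMultiplication.MatrixMultiplication.Theorems.SieveSound_proof` @ eac0f0ad8e10 (its module imports this route file, so no `_holds` link can be stated here).

/-- item stmt-MatrixMultiplication-19764 · assembly · rank 1 · closed · proved by Summit.MatrixMultiplication.MatrixMultiplication.Theorems.Assembly_proof @ eac0f0ad8e10 (prover) · by planner
sources: arXiv:math/0511460
[assembly] the assembly implication SieveSound → ShapeExclusionTE → TEOrder125 → TEResidualSmall →
TEResidualLarge → the rung leaf: restrict a family to its members with nonempty sets (volume-0
members contribute 0), treat ≤ 1 member by U1 (V^{5/6} ≤ V ≤ |H|), else SieveSound +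
ShapeExclusionTE + the order cruxes. -/
@[route_item "route-MatrixMultiplication-AbelianSTPPCensus", crux]
def Assembly : Prop :=
  Summit.MatrixMultiplication.MatrixMultiplication.Theses.AbelianSTPPCensus.SieveSound → Summit.MatrixMultiplication.MatrixMultiplication.Theses.AbelianSTPPCensus.ShapeExclusionTE → Summit.MatrixMultiplication.MatrixMultiplication.Theses.AbelianSTPPCensus.TEOrder125 → Summit.MatrixMultiplication.MatrixMultiplication.Theses.AbelianSTPPCensus.TEResidualSmall → Summit.MatrixMultiplication.MatrixMultiplication.Theses.AbelianSTPPCensus.TEResidualLarge → Summit.MatrixMultiplication.MatrixMultiplication.Theorems.NoAbelianSTPPHost_250_127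

-- `Assembly` holds: proved by `Summit.MatrixMultiplication.MatrixMultiplication.Theorems.Assembly_proof` @ eac0f0ad8e10 (its module imports this route file, so no `_holds` link can be stated here).

/-! D-0027 §2.1 — DECIDING THEOREM (planner-authored via `route open/edit --closes-file`; by planner-mm-stpp-plan-g3-0 2026-08-25T22:13:41Z) — ARCHIVED: route closed (proved) 2026-08-26T09:30:57Z; kept so importers keep building:
its hypotheses are this route's items and its conclusion the registered leaf `Summit.MatrixMultiplication.MatrixMultiplication.Theorems.NoAbelianSTPPHost_250_127` (rung F-M1.T_E/127, D-0061) (glue_lint), and it elaborates with this file. -/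

@[closes "route-MatrixMultiplication-AbelianSTPPCensus"] theorem closes (h₀ : SieveSound) (h₁ : ShapeExclusionTE) (h₂ : TEOrder125)
    (h₃ : TEResidualSmall) (h₄ : TEResidualLarge) (hg : Assembly) :
    Summit.MatrixMultiplication.MatrixMultiplication.Theorems.NoAbelianSTPPHost_250_127 :=
  hg h₀ h₁ h₂ h₃ h₄

end Summit.MatrixMultiplication.MatrixMultiplication.Theses.AbelianSTPPCensus
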